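import Summits.BirchSwinnertonDyer.BirchSwinnertonDyer.Theorems.SignedLowerHalvesBDKimSignedCharValueRankZeroOfCassels
import Literature.NumberTheory.EllipticCurves.BDKim2013.NoProperFiniteIndexSubmodule
import HarnessLib

/-!
# B. D. Kim 2013 Cor. 3.15 (`BDKim2013.cor315_signedCharValue_rankZero`, item stmt-BirchSwinnertonDyer-19288 BY
# NAME) from THREE NAMED FACTS and nothing else: Cassels' theorem (`Greenberg1999.casselsSurjectivity_H1Sigma ℚ`),
# Kim's «`g_v` injective for `v ∣ p`» (`BDKim2013.cor315proof_localResOver_eq_zero_of_layerToInfty_mem_signedSelmerInfty`)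
# and Kim's Thm. 3.14 (`BDKim2013.thm314_signedSelmerDual_noFiniteSubmodule`) — the by-name corollary

LADDER-BSD D-0154 (2) INPUTS→UNCONDITIONAL, INPUTS-LIST-2 row F10, seat `bsd-inputs-kim315-p1`. Sequel (one line
each) of `…Theorems/SignedLowerHalvesBDKimSignedCharValueRankZeroOfCassels.lean` (p610076:
`KimCor315.cor315_of_casselsSurjectivity_of_localInj_of_thm314`, whose displayed hypotheses `hINJ` / `hKIM` are
now the Literature named facts of `BDKim2013/NoProperFiniteIndexSubmodule.lean`, p610386). RESULT: the by-name
input F10 of the packs `PublishedSignedInputs` (19005) / `PublishedInputsX6` (20302) — a whole published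
COROLLARY vendored as one fact — is now a kernel theorem CONDITIONAL on exactly three printed statements
{Greenberg LNM 1716 Prop. 4.13 (Cassels–Poitou–Tate), Kim 2013 proof of Cor. 3.15 step at `v ∣ p` (= Kobayashi
(9.33)), Kim 2013 Thm. 3.14}, each cited verbatim; the control diagram, Greenberg's Lemmas 3.2 / 4.2 / 4.3,
`E(ℚ)[p] = 0`, and the Tamagawa count `|ker g_v| = c_v^{(p)}` (`v ∤ p`) are kernel-checked. Also recorded: the
COTORSION of `X^±(E/ℚ_∞)` in rank `0` (the hypothesis of Kim's Thm. 3.14 and the torsion clause of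
`Kobayashi2003.thm12_signedSelmerDual_finite_torsion` for curves with `Sel_{p^∞}(E/ℚ)` finite) follows from the
local fact ALONE (no Cassels): INJ^ε ⇒ `ker g^ε` finite (`SignedEC.finite_signedKerG_of_localResOver_eq_zero`,
Greenberg's Lemma 3.3 at the bad `v ∤ p`) ⇒ `A^ε_0` finite ⇒ `(Sel^ε_∞)^γ` finite ⇒ torsion.

HONEST FRAMING: THEOREMS ONLY (no definition, no named fact, no `sorry`); CONDITIONAL results (the gate records
`conditional-result` on the three facts); the item is NOT closed; nothing about any curve is asserted
unconditionally; BSD is not proved by any of this.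

References: [BDKim2013] Cor. 3.15 and proof (pp. 199–200), Thm. 3.14 (p. 198); [GreenbergLNM1716] §4 Prop. 4.13
(p. 122), Lemmas 4.2–4.7, §3 Lemma 3.3; [Kobayashi2003] Thm. 1.2, (9.33), Thm. 9.3.
-/

set_option autoImplicit false
-- the Theorems namespace of this sub repeats the summit name by design (D-0017 nested layout)
set_option linter.dupNamespace false

noncomputable section

open scoped Classical NumberField

open NumberField IsDedekindDomain

namespace Summit.BirchSwinnertonDyer.BirchSwinnertonDyer.Theorems.KimCor315

open Literature.NumberTheory.EllipticCurves Literature.NumberTheory.GaloisRepresentations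
  WeierstrassCurve ZpExtension Literature.NumberTheory.EllipticCurves.Kobayashi2003
  Literature.NumberTheory.EllipticCurves.IwasawaDual Literature.NumberTheory.EllipticCurves.IwasawaAlgebra
  Summit.BirchSwinnertonDyer.BirchSwinnertonDyer.Theorems.SignedEC

/-! ## §1 The fact and the three route decls from the three named facts BY NAME -/

/-- **B. D. Kim 2013 Cor. 3.15 (`F = ℚ`, `p` odd) — the Literature fact `BDKim2013.cor315_signedCharValue_rankZero` —
from Cassels' theorem, Kim's local step «`g_v` injective for `v ∣ p`» and Kim's Thm. 3.14, ALL BY NAME.**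
[cite: BDKim2013, Cor. 3.15 (p. 199) and proof (pp. 199–200), Thm. 3.14 (p. 198)]
[cite: GreenbergLNM1716, §4 Prop. 4.13 (p. 122)] -/
theorem cor315_of_print (hC : Greenberg1999.casselsSurjectivity_H1Sigma ℚ)
    (hI : BDKim2013.cor315proof_localResOver_eq_zero_of_layerToInfty_mem_signedSelmerInfty)
    (hK : BDKim2013.thm314_signedSelmerDual_noFiniteSubmodule) :
    BDKim2013.cor315_signedCharValue_rankZero :=
  cor315_of_casselsSurjectivity_of_localInj_of_thm314 hC
    (fun W _ _ p _ hp2 hgood hap κ hκ ε v hv y hy ↦ hI W p hp2 hgood hap κ hκ ε v hv y hy)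
    (fun W _ _ p _ hp2 hgood hap κ γ hκ hγ ε D _ hX ↦ hK W p hp2 hgood hap κ γ hκ hγ ε D hX)

/-- **Route `SignedLowerHalves`, support `BDKimSignedCharValueRankZero` (stmt-BirchSwinnertonDyer-19288) from the three
named facts BY NAME.** CONDITIONAL result: the item is not closed. [cite: BDKim2013, Cor. 3.15 (p. 199)] -/
theorem signedLowerHalves_bdKimSignedCharValueRankZero_of_print (hC : Greenberg1999.casselsSurjectivity_H1Sigma ℚ)
    (hI : BDKim2013.cor315proof_localResOver_eq_zero_of_layerToInfty_mem_signedSelmerInfty)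
    (hK : BDKim2013.thm314_signedSelmerDual_noFiniteSubmodule) :
    Summit.BirchSwinnertonDyer.BirchSwinnertonDyer.Theses.SignedLowerHalves.BDKimSignedCharValueRankZero :=
  cor315_of_print hC hI hK

/-- **Route `SignedBaseChange`, support `BDKimSignedCharValueRankZero` (stmt-BirchSwinnertonDyer-19288) from the three
named facts BY NAME.** CONDITIONAL result: the item is not closed. [cite: BDKim2013, Cor. 3.15 (p. 199)] -/
theorem signedBaseChange_bdKimSignedCharValueRankZero_of_print (hC : Greenberg1999.casselsSurjectivity_H1Sigma ℚ)
    (hI : BDKim2013.cor315proof_localResOver_eq_zero_of_layerToInfty_mem_signedSelmerInfty)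
    (hK : BDKim2013.thm314_signedSelmerDual_noFiniteSubmodule) :
    Summit.BirchSwinnertonDyer.BirchSwinnertonDyer.Theses.SignedBaseChange.BDKimSignedCharValueRankZero :=
  cor315_of_print hC hI hK

/-- **Route `PrintX6`, support `InputKimCor315` (stmt-BirchSwinnertonDyer-19288) from the three named facts BY NAME.**
CONDITIONAL result: the item is not closed. [cite: BDKim2013, Cor. 3.15 (p. 199)] -/
theorem printX6_inputKimCor315_of_print (hC : Greenberg1999.casselsSurjectivity_H1Sigma ℚ)
    (hI : BDKim2013.cor315proof_localResOver_eq_zero_of_layerToInfty_mem_signedSelmerInfty)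
    (hK : BDKim2013.thm314_signedSelmerDual_noFiniteSubmodule) :
    Summit.BirchSwinnertonDyer.BirchSwinnertonDyer.Theses.PrintX6.InputKimCor315 :=
  cor315_of_print hC hI hK

/-! ## §2 Cotorsion in rank `0` from the local fact ALONE -/

/-- **`X^ε(E/ℚ_∞)` is `Λ`-torsion whenever `Sel_{p^∞}(E/ℚ)` is finite — from Kim's local step «`g_v` injective for
`v ∣ p`» ALONE (no Cassels, no Thm. 3.14).** For `W/ℚ` elliptic, globally minimal, `p ≠ 2` good with `a_p = 0`, the
cyclotomic `κ` with topological generator `γ`, any sign and any Pontryagin-dual datum `D`: INJ^ε gives `ker g^ε =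
A^ε_0/Sel_0` finite (`SignedEC.finite_signedKerG_of_localResOver_eq_zero`: Greenberg's localisation at `n = 0`,
Lemma 3.3 at the bad `v ∤ p`), hence `A^ε_0` finite, `(Sel^ε_∞)^γ` finite (Lemma 3.2) and `X^ε` torsion
(`BDKim2013.isTorsion_of_finite_selmerGroup_of_finite_kerG`, Greenberg's Thm. 1.4 argument) — the first sentence of
Kim's proof of Cor. 3.15 («our assumption implies that `Sel^±_p(E/F_∞)` is `Λ`-cotorsion because the control theorem
holds true for the plus/minus Selmer groups (see [8, Theorem 9.3])»), i.e. the torsion clause of Kobayashi's Thm. 1.2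
(`Kobayashi2003.thm12_signedSelmerDual_finite_torsion`) for curves of `p^∞`-Selmer rank `0`, conditional on the
local fact only. [cite: BDKim2013, proof of Cor. 3.15 (p. 199)] [cite: Kobayashi2003, Thm. 9.3 (pp. 26–27) and Thm. 1.2]
[cite: GreenbergLNM1716, §3 Lemmas 3.2–3.3, §1 Thm. 1.4] -/
theorem isTorsion_of_localInj_of_finite_selmerGroup
    (hI : BDKim2013.cor315proof_localResOver_eq_zero_of_layerToInfty_mem_signedSelmerInfty)
    (W : WeierstrassCurve ℚ) [W.IsElliptic] [W.IsGloballyMinimal] (p : ℕ) [Fact p.Prime]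
    (hp2 : p ≠ 2) (hgood : W.HasGoodReductionAtPrime p) (hap : W.frobeniusTrace p = 0)
    (κ : ZpExtension ℚ p) {γ : Field.absoluteGaloisGroup ℚ} (hκ : κ.IsCyclotomic) (hγ : κ.IsTopGenerator γ)
    (ε : ℤˣ) (D : SignedSelmerDualData W κ γ ε) (hSel : Finite (W.selmerGroupPInfty p)) :
    Module.IsTorsion (IwasawaAlgebra p) D.X :=
  BDKim2013.isTorsion_of_finite_selmerGroup_of_finite_kerG W κ ε hγ D hSel
    (finite_signedKerG_of_localResOver_eq_zero W κ ε (fun v hv y hy ↦ hI W p hp2 hgood hap κ hκ ε v hv y hy))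

/-- **Hence Kim's Thm. 3.14 is needed in Cor. 3.15 only for TORSION data that ARE torsion: under INJ^ε the fact
`thm314_…` applies to every datum of a curve with finite `Sel_{p^∞}(E/ℚ)`**, giving `#(Sel^ε_∞)_γ = 1` outright (the
coinvariants are finite by Greenberg's Lemma 4.2, `BDKim2013.constantCoeff_charGenerator_mul_natCard_signedEndCoinvariants`,
and trivial by the kernel equivalence `SignedEC.natCard_signedEndCoinvariants_eq_one_iff_forall_finite_eq_bot`).
[cite: BDKim2013, Thm. 3.14 (p. 198) and proof of Cor. 3.15 (p. 200)] [cite: GreenbergLNM1716, §4 Lemma 4.2, p. 104] -/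
theorem natCard_signedEndCoinvariants_eq_one_of_localInj_of_thm314
    (hI : BDKim2013.cor315proof_localResOver_eq_zero_of_layerToInfty_mem_signedSelmerInfty)
    (hK : BDKim2013.thm314_signedSelmerDual_noFiniteSubmodule)
    (W : WeierstrassCurve ℚ) [W.IsElliptic] [W.IsGloballyMinimal] (p : ℕ) [Fact p.Prime]
    (hp2 : p ≠ 2) (hgood : W.HasGoodReductionAtPrime p) (hap : W.frobeniusTrace p = 0)
    (κ : ZpExtension ℚ p) {γ : Field.absoluteGaloisGroup ℚ} (hκ : κ.IsCyclotomic) (hγ : κ.IsTopGenerator γ)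
    (ε : ℤˣ) (hSel : Finite (W.selmerGroupPInfty p)) :
    Nat.card (EndCoinvariants (conjSignedSelmerInfty W κ ε γ - 1)) = 1 := by
  obtain ⟨D⟩ := nonempty_signedSelmerDualData W κ ε hγ
  haveI := D.moduleFinite hγ
  have hinj : ∀ v : HeightOneSpectrum (𝓞 ℚ), (p : 𝓞 ℚ) ∈ v.asIdeal →
      ∀ y ∈ (signedSelmerInfty W κ ε).comap (W.layerToInfty κ 0),
        W.localResOver p (κ.layerSubgroup 0) (v.adicCompletion ℚ) y = 0 :=
    fun v hv y hy ↦ hI W p hp2 hgood hap κ hκ ε v hv y hy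
  have hkerg := finite_signedKerG_of_localResOver_eq_zero W κ ε hinj
  have hA := finite_comap_layerToInfty_signedSelmerInfty_of_finite W κ ε hSel hkerg
  have hSγ := finite_endInvariants_conjSignedSelmerInfty_of_finite_comap W κ ε hγ hA
  have htor : Module.IsTorsion (IwasawaAlgebra p) D.X := D.isTorsion_of_finite_endInvariants hγ hSγ
  obtain ⟨f, hf⟩ := (charIdeal_isPrincipal_holds p D.X).principal
  have hf' : D.charIdeal = Ideal.span {f} := hf
  obtain ⟨hco, -⟩ :=
    BDKim2013.constantCoeff_charGenerator_mul_natCard_signedEndCoinvariants W κ ε D hγ htor f hf' hSγ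
  exact (natCard_signedEndCoinvariants_eq_one_iff_forall_finite_eq_bot D hγ hco).mpr
    (hK W p hp2 hgood hap κ γ hκ hγ ε D htor)

end Summit.BirchSwinnertonDyer.BirchSwinnertonDyer.Theorems.KimCor315

end
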